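import Mathlib.Topology.Algebra.Category.ProfiniteGrp.Completion
import Literature.AnabelianGeometry.AbsoluteAnabelian.GaloisTheaters
import Literature.AnabelianGeometry.AbsoluteAnabelian.ArchimedeanLogFrobenius
import HarnessLib

/-!
# [AbsTopIII] Def 4.1 (ii) / Def 5.1 (ii): NON-VACUITY of the archimedean records `AutHolPair.Hom` and
# (the §5 stub) `AutHolOrbispace` (rows «NV-L4/AutHolPair.Hom», «NV-L4/AutHolOrbispace»)

S. Mochizuki, *Topics in absolute anabelian geometry III*, J. Math. Sci. Univ. Tokyo 22 (2015); manuscript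
pages: Def 4.1 (ii) p. 102 ("a morphism of Aut-holomorphic `T`-pairs `φ : (𝕏₁ ↶ M₁) → (𝕏₂ ↶ M₂)` … a
morphism `φ_M : M₁ → M₂` … together with a compatible finite étale morphism `φ_𝕏 : 𝕏₁ → 𝕏₂`"), Def 5.1 (ii)
p. 114 (the Aut-holomorphic orbispaces `X(Π_X, v)` with their fields `A_X` of Cor 2.9 and `π₁(X)^∧`).
PROOF-ONLY companion (no `def`, no `instance`, no `structure`) of abc-iut-L4-t2's `ArchimedeanLogFrobenius.lean`
(`AutHolPair`, `AutHolPair.Hom`) and abc-iut-L4-t3's `GaloisTheaters.lean` (stub `AutHolOrbispace`,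
`AutHolOrbispace.Iso`).  abc-iut-w5-d197's INHABITATION CENSUS L4 v1 lists `AutHolPair.Hom` (§A, [hom]) and
`AutHolOrbispace` (§A′, field-only) with ZERO producers; this file records, kernel-checked:

* `isFiniteEtale_id` — the identity of any topological space is finite étale (a covering map with
  one-point fibres; Mathlib has no named `IsCoveringMap id`, proved here from the definition);
* `AutHolPair.nonempty_hom_refl` — GENERAL: every Aut-holomorphic `T`-pair `P` has the identity
  endomorphism (`φ_𝕏 = id`, a morphism of Aut-holomorphic structures by L4's `AutHolStructure.isMorphism_id`,
  finite étale; `φ_M = id`, `𝒜`-part `= id`, Kummer-compatible), which is both a `T`-isomorphism and a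
  structure-isomorphism (`exists_hom_isTIso_and_isStructureIso`);
* `AutHolOrbispace.nonempty_model` / `exists_model` — a GENUINE inhabitant of the §5 stub at universe 0:
  carrier the thrice-punctured Riemann sphere `ℂ ∖ {0, 1}` (subspace topology), `A_X := ℂ`, and
  `π₁(X)^∧ :=` Mathlib's profinite completion of the free group `F₂` (`π₁(ℙ¹ ∖ {0,1,∞}) ≅ F₂` is classical and
  NOT proved here — the stub carries no law tying its three fields, so each is supplied as the printed
  object and the label is `_model` field-by-field);
* `AutHolOrbispace.nonempty_iso_refl` — the identity isomorphism of any object of the stub.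

HONEST FRAMING: witnesses are consistency evidence for OUR typed interfaces only; nothing of [AbsTopIII] is
asserted; no bearing on, and no side taken on, [IUTchIII] Cor 3.12.
-/

namespace Literature.AnabelianGeometry.AbsoluteAnabelian

open _root_.TopologicalSpace _root_.Topology

universe u

/-! ### The identity is finite étale -/

/-- The identity map of a topological space is a covering map (every point evenly covered with the
one-point fibre). [folklore] -/
private theorem isCoveringMap_id' (X : Type u) [TopologicalSpace X] : IsCoveringMap (fun x : X => x) := by
  intro x
  have h : IsEvenlyCovered (fun x : X => x) x PUnit.{u + 1} := by
    refine ⟨inferInstance, Set.univ, Set.mem_univ _, isOpen_univ, isOpen_univ, ?_, ?_⟩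
    · exact (Homeomorph.prodPUnit _).symm
    · intro y; rfl
  exact h.to_isEvenlyCovered_preimage

/-- The identity of `X^top` is a **finite étale** morphism (a covering space map with finite — indeed
one-point — fibres), as Def 4.1 (ii) requires of `φ_𝕏` for the identity morphism of a pair.
[cite: MochizukiAbsTopIII2015, Definition 2.1 (ii) p.51] -/
theorem isFiniteEtale_id (X : Type u) [TopologicalSpace X] : IsFiniteEtale (fun x : X => x) where
  isCoveringMap := isCoveringMap_id' X
  finite_fibre y := (Set.finite_singleton y).subset fun _ hz => hz

/-! ### `AutHolPair.Hom`: the identity morphism -/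

namespace AutHolPair

/-- **Def 4.1 (ii)** — GENERAL witness: every Aut-holomorphic `T`-pair `P = (𝕏 ↶^κ M)` carries the identity
morphism `P → P` (`φ_𝕏 = id_U` is a morphism of Aut-holomorphic structures — L4's
`AutHolStructure.isMorphism_id` — and finite étale; `φ_M = id_M`, `𝒜`-part `id`, compatible with `κ_M`).
[cite: MochizukiAbsTopIII2015, Definition 4.1 (ii) p.102] -/
theorem nonempty_hom_refl (P : AutHolPair.{u}) : Nonempty (P.Hom P) :=
  ⟨{ homU := fun x => x
     isMorphism := P.X.str.isMorphism_id
     finiteEtale := isFiniteEtale_id P.U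
     homA := RingHom.id _
     homM := MonoidHom.id _
     continuous_homM := continuous_id
     kummer_compat := fun _ => rfl }⟩

/-- **Def 4.1 (ii)**: the identity morphism is both a `T`-isomorphism (`φ_M` bijective and open) and a
structure-isomorphism (`φ_𝕏` bijective and open) — so the two sub-notions are non-vacuous on every pair.
[cite: MochizukiAbsTopIII2015, Definition 4.1 (ii) p.102] -/
theorem exists_hom_isTIso_and_isStructureIso (P : AutHolPair.{u}) :
    ∃ φ : P.Hom P, φ.IsTIso ∧ φ.IsStructureIso :=
  ⟨{ homU := fun x => x
     isMorphism := P.X.str.isMorphism_id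
     finiteEtale := isFiniteEtale_id P.U
     homA := RingHom.id _
     homM := MonoidHom.id _
     continuous_homM := continuous_id
     kummer_compat := fun _ => rfl },
    ⟨Function.bijective_id, IsOpenMap.id⟩, ⟨Function.bijective_id, IsOpenMap.id⟩⟩

end AutHolPair

/-! ### The §5 stub `AutHolOrbispace`: a genuine inhabitant and the identity isomorphism -/

namespace AutHolOrbispace

/-- **Def 5.1 (ii)** — NON-VACUITY of abc-iut-L4-t3's stub `AutHolOrbispace` (model, universe `0`): the
Aut-holomorphic orbispace of the thrice-punctured sphere — carrier `ℂ ∖ {0,1}` with the subspace topology,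
`A_X := ℂ` (Cor 2.9's field), `π₁(X)^∧ := F̂₂`, Mathlib's profinite completion of the free group on two
generators (the stub records no law relating its fields; `π₁(ℙ¹ ∖ {0,1,∞}) ≅ F₂` is classical, not proved here).
[cite: MochizukiAbsTopIII2015, Definition 5.1 (ii) p.114] -/
theorem nonempty_model : Nonempty AutHolOrbispace.{0} :=
  ⟨{ carrier := {z : ℂ // z ≠ 0 ∧ z ≠ 1}
     fieldA := ℂ
     pi1Hat := ProfiniteGrp.ProfiniteCompletion.completion (GrpCat.of (FreeGroup (Fin 2))) }⟩

/-- **Def 5.1 (ii)** — the model inhabitant with its three fields read back (carrier `ℂ ∖ {0,1}`, `A_X = ℂ`,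
`π₁^∧ = F̂₂`). [cite: MochizukiAbsTopIII2015, Definition 5.1 (ii) p.114] -/
theorem exists_model :
    ∃ X : AutHolOrbispace.{0}, X.carrier = {z : ℂ // z ≠ 0 ∧ z ≠ 1} ∧ X.fieldA = ℂ ∧
      X.pi1Hat = ProfiniteGrp.ProfiniteCompletion.completion (GrpCat.of (FreeGroup (Fin 2))) :=
  ⟨{ carrier := {z : ℂ // z ≠ 0 ∧ z ≠ 1}
     fieldA := ℂ
     pi1Hat := ProfiniteGrp.ProfiniteCompletion.completion (GrpCat.of (FreeGroup (Fin 2))) },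
    rfl, rfl, rfl⟩

/-- **Def 5.1 (iii)** — the identity isomorphism of any object of the stub (identity homeomorphism, identity
of `A_X`, identity of `π₁^∧` as a representative of the identity outer isomorphism).
[cite: MochizukiAbsTopIII2015, Definition 5.1 (iii) p.115] -/
theorem nonempty_iso_refl (X : AutHolOrbispace.{u}) : Nonempty (X.Iso X) :=
  ⟨{ toHomeomorph := Homeomorph.refl _
     fieldIso := RingEquiv.refl _
     pi1Iso := ContinuousMulEquiv.refl _ }⟩

/-- **Def 5.1 (iii)** — isomorphisms of the stub compose (so `Nonempty (X.Iso Y)` is transitive), by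
composing the three components. [cite: MochizukiAbsTopIII2015, Definition 5.1 (iii) p.115] -/
theorem nonempty_iso_trans {X Y Z : AutHolOrbispace.{u}} (e : X.Iso Y) (f : Y.Iso Z) : Nonempty (X.Iso Z) :=
  ⟨{ toHomeomorph := e.toHomeomorph.trans f.toHomeomorph
     fieldIso := e.fieldIso.trans f.fieldIso
     pi1Iso := e.pi1Iso.trans f.pi1Iso }⟩

/-- **Def 5.1 (iii)** — and invert. [cite: MochizukiAbsTopIII2015, Definition 5.1 (iii) p.115] -/
theorem nonempty_iso_symm {X Y : AutHolOrbispace.{u}} (e : X.Iso Y) : Nonempty (Y.Iso X) :=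
  ⟨{ toHomeomorph := e.toHomeomorph.symm
     fieldIso := e.fieldIso.symm
     pi1Iso := e.pi1Iso.symm }⟩

end AutHolOrbispace

end Literature.AnabelianGeometry.AbsoluteAnabelian
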